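import Summits.Ventures.PercRepro2.CaseOneLoopDelete

/-!
# The thickening relation: one theorem for all four transfers
(blind cell PercRepro2, p1 g22; the four kernel transfers — leaf attachment, parallel duplication,
series subdivision, loop addition — packaged as a relation on edge-labelled graphs)

`ThickStep o a₁ a₂ b v E' ends' E ends` says that the graph `(E, ends)` arises from `(E', ends')` by ONE
thickening away from the five marked vertices: attaching a leaf `a₃ ∉ {o, a₁, a₂, v, b}` (so that
`(E', ends')` is `(E, ends)` with the leaf edge deleted), duplicating an edge in parallel, subdividing an
edge by a new vertex `w ∉ {o, a₁, a₂, v, b}`, or adding a loop; `Thickening` is its reflexive–transitive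
closure (an inductive family, since the edge type changes at every step). `ClosedAt E ends v` is the
four forms at `v` for every weight vector. **`closedAt_of_thickening`**: if the statement vertex `v` is
closed in `(E', ends')`, it is closed in every thickening `(E, ends)` — one induction over the closure,
each step one of `fourForms_of_restrict`, `fourForms_of_merge`, `fourForms_of_series`,
`fourForms_of_loop`. Read downward: every instance reduces, by the four typed reduction rules of S5
§2.2, to a residual instance with the same four forms, so the rung's content sits on loopless residual
graphs whose unmarked vertices have degree `≥ 3` — in the kernel. Own code; standard axioms. -/

namespace Summit.Ventures.PercRepro2

namespace CaseOne

universe u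

section Rel
variable {V : Type*}

/-- **One thickening step** away from the five marked vertices: `(E, ends)` is `(E', ends')` with one
leaf attached, one edge duplicated, one edge subdivided, or one loop added. -/
inductive ThickStep (o a₁ a₂ b v : V) :
    (E' : Type u) → [Fintype E'] → [DecidableEq E'] → (E' → Sym2 V) →
      (E : Type u) → [Fintype E] → [DecidableEq E] → (E → Sym2 V) → Prop
  /-- a leaf `a₃ ∉ {o, a₁, a₂, v, b}` hanging at `u` through `e₀` -/
  | leaf (E : Type u) [Fintype E] [DecidableEq E] (ends : E → Sym2 V) (u a₃ : V) (e₀ : E)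
      (hl : IsLeafAt ends u a₃ e₀) (ho : o ≠ a₃) (h1 : a₁ ≠ a₃) (h2 : a₂ ≠ a₃) (hv : v ≠ a₃)
      (hb : b ≠ a₃) :
      ThickStep o a₁ a₂ b v {e : E // e ≠ e₀} (restrictEnds ends e₀) E ends
  /-- a parallel copy `e₁` of the edge `e₀` -/
  | par (E : Type u) [Fintype E] [DecidableEq E] (ends : E → Sym2 V) (e₀ e₁ : E)
      (hpar : ends e₀ = ends e₁) (hne : e₀ ≠ e₁) :
      ThickStep o a₁ a₂ b v {e : E // e ≠ e₁} (restrictEnds ends e₁) E ends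
  /-- an edge `{x, z}` subdivided by a new vertex `w ∉ {o, a₁, a₂, v, b}` -/
  | series (E : Type u) [Fintype E] [DecidableEq E] (ends : E → Sym2 V) (x w z : V) (e₀ e₁ : E)
      (hs : IsSeriesAt ends x w z e₀ e₁) (ho : o ≠ w) (h1 : a₁ ≠ w) (h2 : a₂ ≠ w) (hv : v ≠ w)
      (hb : b ≠ w) :
      ThickStep o a₁ a₂ b v {e : E // e ≠ e₁} (seriesEnds ends e₀ e₁ x z) E ends
  /-- a loop `e₀` at `x` -/
  | loop (E : Type u) [Fintype E] [DecidableEq E] (ends : E → Sym2 V) (x : V) (e₀ : E)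
      (hl : ends e₀ = s(x, x)) :
      ThickStep o a₁ a₂ b v {e : E // e ≠ e₀} (restrictEnds ends e₀) E ends

/-- **Thickening**: finitely many thickening steps — the reflexive–transitive closure of `ThickStep`
as an inductive family (the edge type changes along the way). -/
inductive Thickening (o a₁ a₂ b v : V) :
    (E' : Type u) → [Fintype E'] → [DecidableEq E'] → (E' → Sym2 V) →
      (E : Type u) → [Fintype E] → [DecidableEq E] → (E → Sym2 V) → Prop
  /-- no step -/
  | refl (E : Type u) [Fintype E] [DecidableEq E] (ends : E → Sym2 V) :
      Thickening o a₁ a₂ b v E ends E ends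
  /-- one more step after a thickening -/
  | tail {E' : Type u} [Fintype E'] [DecidableEq E'] {ends' : E' → Sym2 V} {Em : Type u} [Fintype Em]
      [DecidableEq Em] {endsm : Em → Sym2 V} {E : Type u} [Fintype E] [DecidableEq E]
      {ends : E → Sym2 V} (h : Thickening o a₁ a₂ b v E' ends' Em endsm)
      (hstep : ThickStep o a₁ a₂ b v Em endsm E ends) : Thickening o a₁ a₂ b v E' ends' E ends

variable (R : Type*) [CommRing R] [LinearOrder R]

/-- The four forms at `v` for every weight vector on `(E, ends)`. -/
def ClosedAt (o a₁ a₂ b : V) (E : Type u) [Fintype E] [DecidableEq E] (ends : E → Sym2 V) (v : V) :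
    Prop :=
  ∀ (p : E → R), IsProbVec p → FourForms p ends o a₁ a₂ v b

variable {R} [IsStrictOrderedRing R] {o a₁ a₂ b v : V}

/-- One thickening step preserves the closed property. -/
theorem closedAt_of_thickStep {E' : Type u} [Fintype E'] [DecidableEq E'] {ends' : E' → Sym2 V}
    {E : Type u} [Fintype E] [DecidableEq E] {ends : E → Sym2 V}
    (h : ThickStep o a₁ a₂ b v E' ends' E ends) (hc : ClosedAt R o a₁ a₂ b E' ends' v) :
    ClosedAt R o a₁ a₂ b E ends v := by
  cases h with
  | leaf E ends u a₃ e₀ hl ho h1 h2 hv hb =>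
    intro p hp
    exact fourForms_of_restrict p hl ho h1 h2 hv hb (hc (restrictW p e₀) (IsProbVec.restrictW hp e₀))
  | par E ends e₀ e₁ hpar hne =>
    intro p hp
    exact fourForms_of_merge p hpar hne (hc (mergeW p e₀ e₁) (IsProbVec.mergeW hp e₀ e₁))
  | series E ends x w z e₀ e₁ hs ho h1 h2 hv hb =>
    intro p hp
    exact fourForms_of_series p hs ho h1 h2 hv hb (hc (seriesW p e₀ e₁) (IsProbVec.seriesW hp e₀ e₁))
  | loop E ends x e₀ hl =>
    intro p hp
    exact fourForms_of_loop p hl (hc (restrictW p e₀) (IsProbVec.restrictW hp e₀))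

/-- **The closed set of the rung is closed under thickening**: the four forms for every weight vector
at `v` in `(E', ends')` give them at `v` in every thickening `(E, ends)` of `(E', ends')`. -/
theorem closedAt_of_thickening {E' : Type u} [Fintype E'] [DecidableEq E'] {ends' : E' → Sym2 V}
    {E : Type u} [Fintype E] [DecidableEq E] {ends : E → Sym2 V}
    (h : Thickening o a₁ a₂ b v E' ends' E ends) (hc : ClosedAt R o a₁ a₂ b E' ends' v) :
    ClosedAt R o a₁ a₂ b E ends v := by
  induction h with
  | refl => exact hc
  | tail _ hstep ih => exact closedAt_of_thickStep hstep ih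

/-- The four forms for one weight vector on every thickening of a closed graph. -/
theorem fourForms_of_thickening {E' : Type u} [Fintype E'] [DecidableEq E'] {ends' : E' → Sym2 V}
    {E : Type u} [Fintype E] [DecidableEq E] {ends : E → Sym2 V}
    (h : Thickening o a₁ a₂ b v E' ends' E ends) (hc : ClosedAt R o a₁ a₂ b E' ends' v) (p : E → R)
    (hp : IsProbVec p) : FourForms p ends o a₁ a₂ v b :=
  closedAt_of_thickening h hc p hp

end Rel

end CaseOne

end Summit.Ventures.PercRepro2
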